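/-
Copyright: lit-balaban Phase-2 proof seat p08 (gen 9).  Statement-level skeleton of a published paper; no proof claims beyond what
the kernel checks below.
-/
import Literature.MathematicalPhysics.QuantumFieldTheory.BalabanImbrieJaffe1984to88.BIJ88CurlyDkLocDecayTorus

/-!
# `BalabanImbrieJaffe1984to88.BIJ88OpDecay213DkLocTorus` — T. Bałaban, J. Imbrie, A. Jaffe, *Effective action and cluster properties of
the abelian Higgs model*, Commun. Math. Phys. **114** (1988) 257–315 [BalabanImbrieJaffe1988], Sect. 2 p. 261 [PDF 5]: **THE PRINTED
OPERATOR FORM OF (2.13), `|(𝒟_{k,loc}f)(b)| ≦ ce^{−c dist(suppt f, b)}‖f‖_∞` FOR ALL `b` (no distance threshold), FOR THE CONCRETE TORUS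
OBJECT OF RECORD** (r18's (2.12) `BIJ88CurlyDkLocTorus.dkLocKer` at the printed weights `(η_k^d, L^k)`, acting on `η`-lattice functions
with the `η^d` pairing weight of (I.4.1.1)), constants uniform in `k` and in the radius schedule, **GIVEN ONLY [6I] PROPOSITION 1.2 BY
ITS TREE NAME** (`B5.Prop12Printed`) — file 2 of 2 of seat p08 gen 9 (file 1 = `BIJ88CurlyDkLocDecayTorus`: the kernel decay beyond a
threshold and the diagonal size).

statement-level skeleton of published theorems with citation tags; proofs where landed; nothing here is a claim about the Yang–Mills mass gap

PDF held: `paper:balaban1988-cmp114-bij-abelian-higgs-effective-action` (journal page = PDF page + 256), p. 261 [PDF 5] (text layer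
`~/.lit/texts/paper-balaban1988-cmp114-bij-abelian-higgs-effective-action/p0005.txt` re-read this session); [I] = [BalabanImbrieJaffe1985]
p. 309 [PDF 11] (4.1.1), p. 312 [PDF 14] (4.4.4), p. 325 [PDF 27] (7.2.2); [6I] = [Balaban1984PropagatorsI] Prop. 1.2 (tree name
`Balaban1983to89.B5.Prop12Printed`).

CITATION HEADER (lean-in-tree rule).  Part of the lit-balaban TYPED SKELETON (HOME `run/shared/lean/pub/lit-balaban/`), Phase-2 proof
seat p08 (gen 9), unit `lit-balaban-p08`; free-target protocol G.5-34(d), TAKING line HOME/STATUS.md 2026-08-21T21:04:47Z.  WHAT IS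
REPRODUCED = SKELETON row **C2.Eq2.13** (owner r18, referee ref-5; typed shape r18's `BIJ88Sect2Statements.OpDecay`, abstract hence-step
p08 g4's `BIJ88MultiscaleDecay223.opDecay213_typed` in the regime *scaling factors Λ < 1, no threshold*), FIRST CLAUSE AS PRINTED, kind
«model instance»: PROVED for the concrete (2.12) of record `dkLocKer` (r18 gen 10, p304403).  Decls used BY NAME (nothing restated): r18's
`dkLocKer`/`termKer`/`hlKer`/`clKer`/`kdist`, `dkLocKer_eq_sum`; file 1's `abs_hlKer_le_of_sup`, `abs_clKer_ambient_le`; p09 g8's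
`BIJ88ClocEstimatesTorus.cloc_decay` (HYPOTHESIS-FREE, constants from `(d, L)`); p08 g7's `BIJ88Ineq217Ineq722Torus.exists_bound_of_ineq722`,
`BIJ88Decay216Torus.sum_exp_neg_distEU_le`; p20's `B3TorusRadialSums.sum_exp_neg_supDist_le`; p09's `distEU`/`ctr`/`supDist_ctr_ctr`/
`supDist_triangle`, `ineq722_deltaA_of_prop12Printed`; r18's `applyK`/`supNorm`/`suppDist`/`OpDecay`, p02's `supNorm_nonneg`/`abs_le_supNorm`.

THE PRINTED TEXT (p. 261 [PDF 5], verbatim): *"This propagator derives its regularity and decay from that of C^{(j)}_{loc} and H_{k,loc}.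
Thus |(𝒟_{k,loc}f)(b)| ≦ ce^{−c dist(suppt f, b)}‖f‖_∞ (2.13) and similarly for derivatives of 𝒟_{k,loc} and Hölder derivatives of
order less than 2."*

THE READING OF `(𝒟_{k,loc}f)(b)` (kind «model instance»; the one point that needs a sentence).  The propagators of [I]/[this paper] on the
`η`-lattice are covariances for the pairing *"⟨A, J⟩ = Σ_b η^dA_bJ_b"* of (I.4.1.1) (p09's `BIJ85AxialPropagator411.torusPropagator`
docstring; in the tree `torusPropagator w c k = w • ι⁻¹ ∘ GaxE P w c k ∘ ι`, p11's `BIJ85Prop522Torus.torusPropagator_eq_GaxE`, `w = η^d`):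
the OPERATOR of the functional integral acting on a source `f` is `η^d` times the operator whose Euclidean matrix is the covariance
FUNCTION.  The entries of r18's `dkLocKer (η_k^d) (L^k)` — built from the Euclidean matrix entries of p11's `HkE`, `CE` exactly as p08 g8's
kernel `dkKernel_eq_sum` of `DkE` (r18's `dkE_eta_eq`: `η^{−(d−2)}` times the unit-weight one, [I] p. 326 *"singularities on the
diagonal"*) — are the covariance-function values `𝒟_{k,loc}(b, b″)` of (2.12) (those of the display *"𝒟_{k,loc}(b₁,b₂) = 0 for dist(b₁,b₂) ≧
½r(e_k)"*, r18's `vanishes_dkLocKer`).  Hence the printed operator is **`(𝒟_{k,loc}f)(b) = Σ_{b″∈T_η} η^d·𝒟_{k,loc}(b, b″)f(b″)`**, i.e.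
r18's `applyK` of the kernel `opKer ρ k b b″ := η_k^d·dkLocKer (η_k^d) (L^k) ρ k b b″` (a local abbreviation inside statements only; no
`def`).  In this normalization the diagonal singularity `η^{−(d−2)}` of file 1 §5 is integrable: the scale-`j` term has `η`-lattice row
sums `≲ (L^{k−j})^{−2}` (`η_k^d·(L^j)^d·(L^{k−j})^{d−2} = (L^{k−j})^{−2}`: the volume `(L^j)^d` of an `L^jη`-block against the scaling
factor) — the regime *"scaling factors Λ = L^{−2} < 1, no threshold"* of p08 g4's `BIJ88MultiscaleDecay223.multiscale_sum_le_of_lt_one`,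
which is why (2.13), unlike (2.16)/(2.23), carries no condition `dist ≧ c`.

WHAT IS PROVED (0 `sorry`, standard axioms; theorems only — proof lane; every `d ≥ 2`):
* §1 `abs_applyK_le_of_weighted_rowsum` (generic: a weighted row sum `Σ_a|K(b,a)|e^{c·dist(a,b)} ≤ S` gives
  `|(Kf)(b)| ≤ S·e^{−c·dist(suppt f,b)}‖f‖_∞` — the form of (2.13) with two constants).
* §2 geometry and lattice sums: `kdist_le_legs` (`dist_k(b″,b) ≤ dist(b″,b₂) + |b₁₋−b₂₋|_∞ + dist(b,b₁)` through the block centres,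
  `j ≤ k`), `sum_fine_exp_neg_distEU_le` (**the fine-lattice row sum `Σ_{x∈T_η} e^{−a dist(x,y)} ≤ (L^j)^d(2(1+d/a))^d`** — the volume of a
  block), bond versions `sum_fineBond_exp_le`, `sum_bond_exp_neg_supDist_le`, `sum_bond_exp_neg_distEU_le`.
* §3 **`weighted_rowsum_triple_le`** (kernel-generic, the heart): `|h| ≤ Me^{−δ dist}`, `|C| ≤ M_Ce^{−δ_C|·|_∞}` ⟹
  `Σ_{b″}|Σ_{b₁b₂}h(b,b₁)C(b₁,b₂)h(b″,b₂)|·e^{a·dist_k(b″,b)} ≤ M²M_C·d³e^{a/2}K(a)³·(L^j)^d`, `a = min(δ,δ_C)/2`, `K(a) = (2(1+d/a))^d`.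
* §4 **`weighted_rowsum_termLoc_le`** (the scale-`j` term of the object of record with the `η^d` weight: `≤ M²M_C·d³e^{a/2}K(a)³·(L^{k−j})^{−2}`,
  ANY radius schedule) and **`weighted_rowsum_dkLocKer_le`** (`Σ_{j<k}(L^{k−j})^{−2} ≤ 1`: `Σ_{b″} η^d|𝒟_{k,loc}(b,b″)|e^{a·dist_k(b″,b)} ≤
  M²M_C·d³e^{a/2}K(a)³ =: S`, uniform in `k ≤ m + K` and `ρ`).
* §5 **(2.13) FOR THE OBJECT OF RECORD**: `abs_apply_dkLoc_le` (`|(𝒟_{k,loc}f)(b)| ≤ S·e^{−a·dist_k(suppt f,b)}‖f‖_∞` for ALL `b`, explicit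
  `S, a` from the (7.2.2)/(2.5)-analogue constants), `opDecay213_dkLoc_of_ineq722` (from r15's typed (7.2.2) for p09's kernel family + p09
  g8's hypothesis-free `cloc_decay`), **`opDecay213_dkLoc_prop12`** (`∃ c₁ δ′ > 0 ∀ k ≤ m + K ∀ ρ ∀ f b`, GIVEN ONLY `B5.Prop12Printed`) and
  **`opDecay213_dkLoc_typed_prop12`** (r18's one-letter row shape `OpDecay (κ·dist_k) 𝒟_{k,loc} c` inhabited, necessarily in a rescaled
  distance `κ·dist_k`: threshold-free, prefactor = rate = `c`).
HONEST SCOPE.  (i) The `η^d`-weighted action is the reading stated above (with its in-tree witnesses); for the bare Euclidean-matrix action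
`Σ_{b″}𝒟_{k,loc}(b,b″)f(b″)` no `k`-uniform bound of the printed shape holds at `d ≥ 2` (file 1 §5: diagonal `≍ Σ_{j<k}(L^{k−j})^{d−2}`).  (ii)
The remaining hypothesis is [6I] Proposition 1.2 BY NAME for p09's torus settings (the `h12` of rows C1.Eq7.2.1-7.2.2 / C2.Eq2.16), constants
existential PER TORUS `P` (cf. GAPS G-C1-07), uniform in `k ≤ m + K` and in `ρ`; the `C^{(j)}_{loc}` constants depend on `(d, L)` only (p09).
(iii) `dist(suppt f, b)` = r18's `suppDist` of `dist_k` = `|·|_∞/L^k` (units of `T₁^{(k)}`, `ℓ¹ ≤ d·ℓ^∞`); r18's one-letter shape is met only in a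
rescaled distance (three honest constants otherwise), as for every typed one-letter row of this section.  (iv) The derivative / Hölder clauses
of (2.13) are NOT proved here.  (v) `U = 1`, real abelian fields, torus, standing range; no smallness of `e_k`, no property of the cutoffs
beyond `0 ≤ ζ ≤ 1`.  (vi) No `def`, no new named fact, nothing restated; NOT summit progress.  Unit `lit-balaban-p08`
(literature-prover-lit-balaban-p08-g9-0), 2026-08-21.
-/

open scoped BigOperators RealInnerProductSpace

namespace Literature.MathematicalPhysics.QuantumFieldTheory.BalabanImbrieJaffe1984to88.BIJ88OpDecay213DkLocTorus

open Balaban1983to89 hiding Site Plaq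
open Balaban1983to89.LatticeFieldCalculus
open BIJ88Ineq217Ineq722Torus (exists_bound_of_ineq722 torusKernelData_gradH_nonneg)
open BIJ88Decay216Torus (sum_exp_neg_distEU_le)
open B3TorusRadialSums (supDist_comm sum_exp_neg_supDist_le)
open BIJ85Prop521Torus BIJ85Prop522Torus BIJ85Sigma422Eta
open BIJ85Sect7Statements BIJ85Ineq722Torus
open BIJ85Ineq722DeltaA (deltaAData ineq722_deltaA_of_prop12Printed)
open BIJ85Ineq722ProofPart2 (settingOf)
open BIJ88ClocFactorsTorus (distB distB_apply)
open BIJ88ClocEstimatesTorus (Cloc cloc_decay)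
open BIJ88Sect2Statements (applyK supNorm suppDist OpDecay)
open BIJ88Close235Proof (supNorm_nonneg abs_le_supNorm)
open BIJ88CurlyDkLocTorus BIJ88CurlyDkLocDecayTorus
-- inside this namespace the bare `Site`/`Plaq` are the `ℤ^d` carriers of the QFT root; the torus ones are renamed:
open Balaban1983to89 renaming Site → TSite, Plaq → TPlaq

noncomputable section

variable {P : Params}

/-! ## §1  From a weighted row sum to the printed operator shape -/

/-- **the shape of (2.13) from a weighted row sum** (generic; two constants): if `Σ_a |K(b,a)|·e^{c·dist(a,b)} ≤ S` (`c ≥ 0`) then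
`|(Kf)(b)| ≤ S·e^{−c·dist(suppt f, b)}·‖f‖_∞` (r18's `applyK`, `suppDist`, `supNorm`): on the support of `f`, `dist(a,b) ≥ dist(suppt f,b)`.
[cite: BalabanImbrieJaffe1988, (2.13) p.261] -/
theorem abs_applyK_le_of_weighted_rowsum {α β : Type*} [Fintype α] {dist : α → β → ℝ} {K : β → α → ℝ} {c S : ℝ}
    (hc : 0 ≤ c) {x : β} (hS : ∑ y, |K x y| * Real.exp (c * dist y x) ≤ S) (f : α → ℝ) :
    |applyK K f x| ≤ S * Real.exp (-c * suppDist dist f x) * supNorm f := by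
  have hsN : 0 ≤ supNorm f := supNorm_nonneg f
  have hterm : ∀ y, |K x y * f y| ≤
      (|K x y| * Real.exp (c * dist y x)) * (Real.exp (-c * suppDist dist f x) * supNorm f) := by
    intro y
    by_cases hy : f y = 0
    · rw [hy, mul_zero, abs_zero]; positivity
    · have hsD : suppDist dist f x ≤ dist y x :=
        ciInf_le (Finite.bddBelow_range fun a : {a // f a ≠ 0} => dist a.1 x) ⟨y, hy⟩
      have hfy : |f y| ≤ supNorm f := abs_le_supNorm f y
      have hexp : 1 ≤ Real.exp (c * dist y x) * Real.exp (-c * suppDist dist f x) := by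
        rw [← Real.exp_add]
        refine Real.one_le_exp_iff.2 ?_
        have := mul_le_mul_of_nonneg_left hsD hc
        linarith
      rw [abs_mul]
      calc |K x y| * |f y| ≤ |K x y| * 1 * supNorm f := by
            rw [mul_one]; exact mul_le_mul_of_nonneg_left hfy (abs_nonneg _)
        _ ≤ |K x y| * (Real.exp (c * dist y x) * Real.exp (-c * suppDist dist f x)) * supNorm f :=
            mul_le_mul_of_nonneg_right (mul_le_mul_of_nonneg_left hexp (abs_nonneg _)) hsN
        _ = _ := by ring
  unfold applyK
  calc |∑ y, K x y * f y| ≤ ∑ y, |K x y * f y| := Finset.abs_sum_le_sum_abs _ _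
    _ ≤ ∑ y, (|K x y| * Real.exp (c * dist y x)) * (Real.exp (-c * suppDist dist f x) * supNorm f) :=
        Finset.sum_le_sum fun y _ => hterm y
    _ = (∑ y, |K x y| * Real.exp (c * dist y x)) * (Real.exp (-c * suppDist dist f x) * supNorm f) := by
        rw [Finset.sum_mul]
    _ ≤ S * (Real.exp (-c * suppDist dist f x) * supNorm f) := mul_le_mul_of_nonneg_right hS (by positivity)
    _ = _ := by ring

/-! ## §2  Geometry and lattice sums on the tori -/

/-- `Σ_b f(b₋) = d·Σ_y f(y)` on `T^{(j)}`. [folklore] -/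
private theorem sum_bond_src {j : ℕ} (f : TSite P j → ℝ) : ∑ b : PBond P j, f b.src = (P.d : ℝ) * ∑ y : TSite P j, f y := by
  rw [← Fintype.sum_equiv (LatticeFieldCalculus.bondEquiv (P := P) (j := j)) (fun q : TSite P j × Fin P.d => f q.1) _
    (fun q => rfl), Fintype.sum_prod_type]
  simp only [Finset.sum_const, Finset.card_univ, Fintype.card_fin, nsmul_eq_mul]
  rw [Finset.mul_sum]

/-- `0 < L^n`. [folklore] -/
private theorem cast_pow_L_pos' (n : ℕ) : (0 : ℝ) < (P.L : ℝ) ^ n := pow_pos P.cast_L_pos n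

/-- `L^k = L^j·L^{k−j}` for `j ≤ k`. [folklore] -/
private theorem pow_eq_pow_mul_pow' {j k : ℕ} (hjk : j ≤ k) : (P.L : ℝ) ^ k = (P.L : ℝ) ^ j * (P.L : ℝ) ^ (k - j) := by
  rw [← pow_add, Nat.add_sub_cancel' hjk]

/-- `η_k = (L^k)⁻¹`. [folklore] -/
private theorem eta_eq_inv' (k : ℕ) : P.eta k = ((P.L : ℝ) ^ k)⁻¹ := by
  rw [Params.eta, inv_pow]

/-- **the legs of `dist_k(b″, b)` through the block centres** (`j ≤ k`, `j ≤ m + K`): `dist_k(b″, b) ≤ dist(b″, b₂) + |b₁₋ − b₂₋|_∞ +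
dist(b, b₁)` — `|b″₋ − b₋|_∞ ≤ |b″₋ − y_{b₂₋}|_∞ + L^j|b₂₋ − b₁₋|_∞ + |y_{b₁₋} − b₋|_∞` and `L^j ≤ L^k` (distances of (7.2.2)/(7.2.3) in units
of `T₁^{(j)}`, `dist_k` in units of `T₁^{(k)}`). [cite: BalabanImbrieJaffe1988, (2.13) p.261] -/
theorem kdist_le_legs {j k : ℕ} (hj : j ≤ P.m + P.K) (hjk : j ≤ k) (b b'' : PBond P 0) (b₁ b₂ : PBond P j) :
    kdist (P := P) k b'' b ≤ distEU P j b''.src b₂.src + (supDist b₁.src b₂.src : ℝ) + distEU P j b.src b₁.src := by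
  have hLj := cast_pow_L_pos' (P := P) j
  have hL1 : (1 : ℝ) ≤ P.L := by exact_mod_cast P.L_pos
  have hjk' : (P.L : ℝ) ^ j ≤ (P.L : ℝ) ^ k := pow_le_pow_right₀ hL1 hjk
  unfold kdist distEU
  have t1 := supDist_triangle b''.src (ctr j b₂.src) b.src
  have t2 := supDist_triangle (ctr j b₂.src) (ctr j b₁.src) b.src
  have e2 : (supDist (ctr j b₂.src) (ctr j b₁.src) : ℝ) = (P.L : ℝ) ^ j * (supDist b₁.src b₂.src : ℝ) := by
    rw [supDist_ctr_ctr hj, supDist_comm b₂.src b₁.src]; push_cast; ring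
  have e3 : supDist (ctr j b₁.src) b.src = supDist b.src (ctr j b₁.src) := supDist_comm _ _
  have hsum : (supDist b''.src b.src : ℝ) ≤ (supDist b''.src (ctr j b₂.src) : ℝ) +
      (P.L : ℝ) ^ j * (supDist b₁.src b₂.src : ℝ) + (supDist b.src (ctr j b₁.src) : ℝ) := by
    rw [← e2, ← e3]; exact_mod_cast t1.trans (by omega)
  calc (supDist b''.src b.src : ℝ) / (P.L : ℝ) ^ k ≤ (supDist b''.src b.src : ℝ) / (P.L : ℝ) ^ j :=
        div_le_div_of_nonneg_left (Nat.cast_nonneg _) hLj hjk'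
    _ ≤ ((supDist b''.src (ctr j b₂.src) : ℝ) + (P.L : ℝ) ^ j * (supDist b₁.src b₂.src : ℝ) +
          (supDist b.src (ctr j b₁.src) : ℝ)) / (P.L : ℝ) ^ j := div_le_div_of_nonneg_right hsum hLj.le
    _ = _ := by field_simp

/-- **THE FINE-LATTICE ROW SUM — the volume of a block**: `Σ_{x∈T_η} e^{−a dist(x, y)} ≤ (L^j)^d·(2(1 + d/a))^d` for the (7.2.2) distance
`dist(x, y) = |x − y_y|_∞/L^j` to the centre of `y ∈ T^{(j)}` (p20's `sum_exp_neg_supDist_le` at rate `a/L^j`; `1 + dL^j/a ≤ L^j(1 + d/a)`).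
[cite: Balaban1983Higgs3, (2.15) p.427] -/
theorem sum_fine_exp_neg_distEU_le (j : ℕ) {a : ℝ} (ha : 0 < a) (y : TSite P j) :
    ∑ x : TSite P 0, Real.exp (-(a * distEU P j x y)) ≤ ((P.L : ℝ) ^ j) ^ P.d * (2 * (1 + P.d / a)) ^ P.d := by
  have hd : 0 < P.d := by have := P.hd; omega
  have hLj := cast_pow_L_pos' (P := P) j
  have hLj1 : (1 : ℝ) ≤ (P.L : ℝ) ^ j := one_le_pow₀ (by exact_mod_cast P.L_pos)
  have e : ∀ x : TSite P 0, Real.exp (-(a * distEU P j x y)) =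
      Real.exp (-(a / (P.L : ℝ) ^ j * (supDist (ctr j y) x : ℝ))) := by
    intro x
    unfold distEU
    rw [supDist_comm x (ctr j y), mul_div_assoc', div_mul_eq_mul_div]
  have e1 : (P.d : ℝ) / (a / (P.L : ℝ) ^ j) = (P.L : ℝ) ^ j * (P.d / a) := by
    rw [div_div_eq_mul_div]; ring
  have hx : 0 ≤ (P.d : ℝ) / a := by positivity
  have key : 2 * (1 + P.d / (a / (P.L : ℝ) ^ j)) ≤ (P.L : ℝ) ^ j * (2 * (1 + P.d / a)) := by
    rw [e1]
    nlinarith [mul_nonneg (sub_nonneg.2 hLj1) hx]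
  calc ∑ x : TSite P 0, Real.exp (-(a * distEU P j x y))
      = ∑ x : TSite P 0, Real.exp (-(a / (P.L : ℝ) ^ j * (supDist (ctr j y) x : ℝ))) := Finset.sum_congr rfl fun x _ => e x
    _ ≤ (2 * (1 + P.d / (a / (P.L : ℝ) ^ j))) ^ P.d := sum_exp_neg_supDist_le (div_pos ha hLj) hd (ctr j y)
    _ ≤ ((P.L : ℝ) ^ j * (2 * (1 + P.d / a))) ^ P.d := pow_le_pow_left₀ (by positivity) key _
    _ = _ := by rw [mul_pow]

/-- the same summed over the `η`-bonds at their sources: `Σ_{b″∈T_η bonds} e^{−a dist(b″₋, y)} ≤ d·(L^j)^d·(2(1 + d/a))^d`.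
[cite: Balaban1983Higgs3, (2.15) p.427] -/
theorem sum_fineBond_exp_le (j : ℕ) {a : ℝ} (ha : 0 < a) (y : TSite P j) :
    ∑ b'' : PBond P 0, Real.exp (-(a * distEU P j b''.src y)) ≤ (P.d : ℝ) * (((P.L : ℝ) ^ j) ^ P.d * (2 * (1 + P.d / a)) ^ P.d) := by
  rw [sum_bond_src (fun x => Real.exp (-(a * distEU P j x y)))]
  exact mul_le_mul_of_nonneg_left (sum_fine_exp_neg_distEU_le j ha y) (Nat.cast_nonneg _)

/-- the unit-lattice bond row sum of the (7.2.3) shape: `Σ_{b₂∈T^{(j)}} e^{−a|b₁₋ − b₂₋|_∞} ≤ d·(2(1 + d/a))^d`. [cite: Balaban1983Higgs3, (2.15) p.427] -/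
theorem sum_bond_exp_neg_supDist_le (j : ℕ) {a : ℝ} (ha : 0 < a) (b₁ : PBond P j) :
    ∑ b₂ : PBond P j, Real.exp (-(a * (supDist b₁.src b₂.src : ℝ))) ≤ (P.d : ℝ) * (2 * (1 + P.d / a)) ^ P.d := by
  have hd : 0 < P.d := by have := P.hd; omega
  rw [sum_bond_src (fun y' => Real.exp (-(a * (supDist b₁.src y' : ℝ))))]
  exact mul_le_mul_of_nonneg_left (sum_exp_neg_supDist_le ha hd b₁.src) (Nat.cast_nonneg _)

/-- the coarse bond row sum of the (7.2.2) shape seen from a fine point: `Σ_{b₁∈T^{(j)}} e^{−a dist(x, b₁)} ≤ d·e^{a/2}(2(1 + d/a))^d` (gen 7's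
`sum_exp_neg_distEU_le`). [cite: Balaban1983Higgs3, (2.15) p.427] -/
theorem sum_bond_exp_neg_distEU_le {j : ℕ} (hj : j ≤ P.m + P.K) {a : ℝ} (ha : 0 < a) (x : TSite P 0) :
    ∑ b₁ : PBond P j, Real.exp (-(a * distEU P j x b₁.src)) ≤ (P.d : ℝ) * (Real.exp (a / 2) * (2 * (1 + P.d / a)) ^ P.d) := by
  rw [sum_bond_src (fun y => Real.exp (-(a * distEU P j x y)))]
  exact mul_le_mul_of_nonneg_left (sum_exp_neg_distEU_le hj ha x) (Nat.cast_nonneg _)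

/-! ## §3  The weighted row sum of one scale term, kernel-generic -/

/-- **THE HEART, KERNEL-GENERIC** (`j ≤ k`, `j ≤ m + K`): for kernels `h(b, b₁)` (`b` an `η`-bond, `b₁ ∈ T^{(j)}`) and `C(b₁, b₂)` on `T^{(j)}`
with `|h| ≤ Me^{−δ dist}` ((7.2.2) shape) and `|C| ≤ M_Ce^{−δ_C|·|_∞}` ((7.2.3) shape), the `η`-LATTICE ROW SUM of the composite against the
exponential weight at rate `a = min(δ, δ_C)/2` is `Σ_{b″∈T_η}|Σ_{b₁b₂}h(b,b₁)C(b₁,b₂)h(b″,b₂)|·e^{a·dist_k(b″,b)} ≤ M²M_C·d³e^{a/2}K(a)³·(L^j)^d`,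
`K(a) = (2(1 + d/a))^d`: half of each rate absorbs the weight through `kdist_le_legs`, the other half pays the three row sums, the `b″`-sum
contributing the block volume `(L^j)^d` — *"This propagator derives its regularity and decay from that of C^{(j)}_{loc} and H_{k,loc}"*.
[cite: BalabanImbrieJaffe1988, (2.13) p.261] -/
theorem weighted_rowsum_triple_le {j k : ℕ} (hj : j ≤ P.m + P.K) (hjk : j ≤ k) {δ M δC MC : ℝ} (hδ : 0 < δ) (hδC : 0 < δC)
    (hM : 0 ≤ M) (hMC : 0 ≤ MC) {h : PBond P 0 → PBond P j → ℝ} {C : PBond P j → PBond P j → ℝ}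
    (hH : ∀ (b₀ : PBond P 0) (b₁ : PBond P j), |h b₀ b₁| ≤ M * Real.exp (-(δ * distEU P j b₀.src b₁.src)))
    (hC : ∀ b₁ b₂ : PBond P j, |C b₁ b₂| ≤ MC * Real.exp (-(δC * (supDist b₁.src b₂.src : ℝ))))
    (b : PBond P 0) :
    ∑ b'' : PBond P 0, |∑ b₁ : PBond P j, ∑ b₂ : PBond P j, h b b₁ * C b₁ b₂ * h b'' b₂| *
        Real.exp (min δ δC / 2 * kdist (P := P) k b'' b) ≤
      M ^ 2 * MC * (P.d : ℝ) ^ 3 * (Real.exp (min δ δC / 2 / 2) * ((2 * (1 + P.d / (min δ δC / 2))) ^ P.d) ^ 3) *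
        ((P.L : ℝ) ^ j) ^ P.d := by
  have ha : 0 < min δ δC / 2 := half_pos (lt_min hδ hδC)
  have haδ : min δ δC / 2 ≤ δ - min δ δC / 2 := by linarith [min_le_left δ δC]
  have haC : min δ δC / 2 ≤ δC - min δ δC / 2 := by linarith [min_le_right δ δC]
  -- pointwise, with the weight absorbed by half of each rate
  have hpt : ∀ (b'' : PBond P 0) (b₁ b₂ : PBond P j),
      |h b b₁ * C b₁ b₂ * h b'' b₂| * Real.exp (min δ δC / 2 * kdist (P := P) k b'' b) ≤
        M ^ 2 * MC * Real.exp (-(min δ δC / 2 * distEU P j b.src b₁.src)) *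
          Real.exp (-(min δ δC / 2 * (supDist b₁.src b₂.src : ℝ))) * Real.exp (-(min δ δC / 2 * distEU P j b''.src b₂.src)) := by
    intro b'' b₁ b₂
    have h1 := hH b b₁
    have h2 := hH b'' b₂
    have h3 := hC b₁ b₂
    have htri := kdist_le_legs hj hjk b b'' b₁ b₂
    have hd1 : 0 ≤ distEU P j b.src b₁.src := div_nonneg (Nat.cast_nonneg _) (cast_pow_L_pos' j).le
    have hd2 : 0 ≤ (supDist b₁.src b₂.src : ℝ) := Nat.cast_nonneg _
    have hd3 : 0 ≤ distEU P j b''.src b₂.src := div_nonneg (Nat.cast_nonneg _) (cast_pow_L_pos' j).le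
    have hprod : |h b b₁| * |C b₁ b₂| * |h b'' b₂| ≤ (M * Real.exp (-(δ * distEU P j b.src b₁.src))) *
        (MC * Real.exp (-(δC * (supDist b₁.src b₂.src : ℝ)))) * (M * Real.exp (-(δ * distEU P j b''.src b₂.src))) :=
      mul_le_mul (mul_le_mul h1 h3 (abs_nonneg _) (by positivity)) h2 (abs_nonneg _) (by positivity)
    have hexp : Real.exp (-(δ * distEU P j b.src b₁.src)) * Real.exp (-(δC * (supDist b₁.src b₂.src : ℝ))) *
        Real.exp (-(δ * distEU P j b''.src b₂.src)) * Real.exp (min δ δC / 2 * kdist (P := P) k b'' b) ≤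
        Real.exp (-(min δ δC / 2 * distEU P j b.src b₁.src)) * Real.exp (-(min δ δC / 2 * (supDist b₁.src b₂.src : ℝ))) *
          Real.exp (-(min δ δC / 2 * distEU P j b''.src b₂.src)) := by
      rw [← Real.exp_add, ← Real.exp_add, ← Real.exp_add, ← Real.exp_add, ← Real.exp_add]
      refine Real.exp_le_exp.2 ?_
      have w := mul_le_mul_of_nonneg_left htri ha.le
      nlinarith [mul_le_mul_of_nonneg_right haδ hd1, mul_le_mul_of_nonneg_right haC hd2, mul_le_mul_of_nonneg_right haδ hd3]
    rw [abs_mul, abs_mul]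
    calc |h b b₁| * |C b₁ b₂| * |h b'' b₂| * Real.exp (min δ δC / 2 * kdist (P := P) k b'' b)
        ≤ (M * Real.exp (-(δ * distEU P j b.src b₁.src))) * (MC * Real.exp (-(δC * (supDist b₁.src b₂.src : ℝ)))) *
            (M * Real.exp (-(δ * distEU P j b''.src b₂.src))) * Real.exp (min δ δC / 2 * kdist (P := P) k b'' b) :=
          mul_le_mul_of_nonneg_right hprod (Real.exp_pos _).le
      _ = M ^ 2 * MC * (Real.exp (-(δ * distEU P j b.src b₁.src)) * Real.exp (-(δC * (supDist b₁.src b₂.src : ℝ))) *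
            Real.exp (-(δ * distEU P j b''.src b₂.src)) * Real.exp (min δ δC / 2 * kdist (P := P) k b'' b)) := by ring
      _ ≤ M ^ 2 * MC * (Real.exp (-(min δ δC / 2 * distEU P j b.src b₁.src)) *
            Real.exp (-(min δ δC / 2 * (supDist b₁.src b₂.src : ℝ))) * Real.exp (-(min δ δC / 2 * distEU P j b''.src b₂.src))) :=
          mul_le_mul_of_nonneg_left hexp (by positivity)
      _ = _ := by ring
  -- the three row sums
  have hS3 : ∀ b₂ : PBond P j, ∑ b'' : PBond P 0, Real.exp (-(min δ δC / 2 * distEU P j b''.src b₂.src)) ≤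
      (P.d : ℝ) * (((P.L : ℝ) ^ j) ^ P.d * (2 * (1 + P.d / (min δ δC / 2))) ^ P.d) := fun b₂ => sum_fineBond_exp_le j ha b₂.src
  have hS2 : ∀ b₁ : PBond P j, ∑ b₂ : PBond P j, Real.exp (-(min δ δC / 2 * (supDist b₁.src b₂.src : ℝ))) ≤
      (P.d : ℝ) * (2 * (1 + P.d / (min δ δC / 2))) ^ P.d := fun b₁ => sum_bond_exp_neg_supDist_le j ha b₁
  have hS1 : ∑ b₁ : PBond P j, Real.exp (-(min δ δC / 2 * distEU P j b.src b₁.src)) ≤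
      (P.d : ℝ) * (Real.exp (min δ δC / 2 / 2) * (2 * (1 + P.d / (min δ δC / 2))) ^ P.d) := sum_bond_exp_neg_distEU_le hj ha b.src
  -- exchange the sums and collect
  have hx : ∀ G : PBond P 0 → PBond P j → PBond P j → ℝ,
      ∑ b'' : PBond P 0, ∑ b₁ : PBond P j, ∑ b₂ : PBond P j, G b'' b₁ b₂ =
        ∑ b₁ : PBond P j, ∑ b₂ : PBond P j, ∑ b'' : PBond P 0, G b'' b₁ b₂ := by
    intro G
    rw [Finset.sum_comm]
    exact Finset.sum_congr rfl fun b₁ _ => Finset.sum_comm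
  set K : ℝ := (2 * (1 + P.d / (min δ δC / 2))) ^ P.d with hK
  have hK0 : 0 ≤ K := by positivity
  calc ∑ b'' : PBond P 0, |∑ b₁ : PBond P j, ∑ b₂ : PBond P j, h b b₁ * C b₁ b₂ * h b'' b₂| *
          Real.exp (min δ δC / 2 * kdist (P := P) k b'' b)
      ≤ ∑ b'' : PBond P 0, (∑ b₁ : PBond P j, ∑ b₂ : PBond P j, |h b b₁ * C b₁ b₂ * h b'' b₂|) *
          Real.exp (min δ δC / 2 * kdist (P := P) k b'' b) :=
        Finset.sum_le_sum fun b'' _ => mul_le_mul_of_nonneg_right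
          ((Finset.abs_sum_le_sum_abs _ _).trans (Finset.sum_le_sum fun b₁ _ => Finset.abs_sum_le_sum_abs _ _)) (Real.exp_pos _).le
    _ = ∑ b'' : PBond P 0, ∑ b₁ : PBond P j, ∑ b₂ : PBond P j, |h b b₁ * C b₁ b₂ * h b'' b₂| *
          Real.exp (min δ δC / 2 * kdist (P := P) k b'' b) := by
        refine Finset.sum_congr rfl fun b'' _ => ?_
        rw [Finset.sum_mul]
        exact Finset.sum_congr rfl fun b₁ _ => Finset.sum_mul _ _ _
    _ ≤ ∑ b'' : PBond P 0, ∑ b₁ : PBond P j, ∑ b₂ : PBond P j, M ^ 2 * MC * Real.exp (-(min δ δC / 2 * distEU P j b.src b₁.src)) *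
          Real.exp (-(min δ δC / 2 * (supDist b₁.src b₂.src : ℝ))) * Real.exp (-(min δ δC / 2 * distEU P j b''.src b₂.src)) :=
        Finset.sum_le_sum fun b'' _ => Finset.sum_le_sum fun b₁ _ => Finset.sum_le_sum fun b₂ _ => hpt b'' b₁ b₂
    _ = ∑ b₁ : PBond P j, ∑ b₂ : PBond P j, (M ^ 2 * MC * Real.exp (-(min δ δC / 2 * distEU P j b.src b₁.src)) *
          Real.exp (-(min δ δC / 2 * (supDist b₁.src b₂.src : ℝ)))) *
          ∑ b'' : PBond P 0, Real.exp (-(min δ δC / 2 * distEU P j b''.src b₂.src)) := by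
        rw [hx]
        refine Finset.sum_congr rfl fun b₁ _ => Finset.sum_congr rfl fun b₂ _ => ?_
        rw [Finset.mul_sum]
    _ ≤ ∑ b₁ : PBond P j, ∑ b₂ : PBond P j, (M ^ 2 * MC * Real.exp (-(min δ δC / 2 * distEU P j b.src b₁.src)) *
          Real.exp (-(min δ δC / 2 * (supDist b₁.src b₂.src : ℝ)))) * ((P.d : ℝ) * (((P.L : ℝ) ^ j) ^ P.d * K)) :=
        Finset.sum_le_sum fun b₁ _ => Finset.sum_le_sum fun b₂ _ => mul_le_mul_of_nonneg_left (hS3 b₂) (by positivity)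
    _ = ∑ b₁ : PBond P j, (M ^ 2 * MC * ((P.d : ℝ) * (((P.L : ℝ) ^ j) ^ P.d * K)) *
          Real.exp (-(min δ δC / 2 * distEU P j b.src b₁.src))) *
          ∑ b₂ : PBond P j, Real.exp (-(min δ δC / 2 * (supDist b₁.src b₂.src : ℝ))) := by
        refine Finset.sum_congr rfl fun b₁ _ => ?_
        rw [Finset.mul_sum]
        exact Finset.sum_congr rfl fun b₂ _ => by ring
    _ ≤ ∑ b₁ : PBond P j, (M ^ 2 * MC * ((P.d : ℝ) * (((P.L : ℝ) ^ j) ^ P.d * K)) *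
          Real.exp (-(min δ δC / 2 * distEU P j b.src b₁.src))) * ((P.d : ℝ) * K) :=
        Finset.sum_le_sum fun b₁ _ => mul_le_mul_of_nonneg_left (hS2 b₁) (by positivity)
    _ = (M ^ 2 * MC * ((P.d : ℝ) * (((P.L : ℝ) ^ j) ^ P.d * K)) * ((P.d : ℝ) * K)) *
          ∑ b₁ : PBond P j, Real.exp (-(min δ δC / 2 * distEU P j b.src b₁.src)) := by
        rw [Finset.mul_sum]
        exact Finset.sum_congr rfl fun b₁ _ => by ring
    _ ≤ (M ^ 2 * MC * ((P.d : ℝ) * (((P.L : ℝ) ^ j) ^ P.d * K)) * ((P.d : ℝ) * K)) *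
          ((P.d : ℝ) * (Real.exp (min δ δC / 2 / 2) * K)) := mul_le_mul_of_nonneg_left hS1 (by positivity)
    _ = _ := by ring

/-! ## §4  The object of record with the `η^d` weight: row sums `≲ (L^{k−j})^{−2}`, summable over the scales -/

/-- the bookkeeping of the weights: `η_k^d·(L^{k−j})^{d−2}·(L^j)^d = (L^{k−j})^{−2}` (`d ≥ 2`, `j ≤ k`) — the pairing weight times the scaling
factor of the `L^jη`-lattice times the volume of an `L^jη`-block. [cite: BalabanImbrieJaffe1988, (2.12) p.261] -/
theorem eta_pow_scaling (hd : 2 ≤ P.d) {j k : ℕ} (hjk : j ≤ k) :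
    (P.eta k) ^ P.d * ((P.L : ℝ) ^ (k - j)) ^ (P.d - 2) * ((P.L : ℝ) ^ j) ^ P.d = (((P.L : ℝ) ^ (k - j)) ^ 2)⁻¹ := by
  obtain ⟨q, hq⟩ : ∃ q, P.d = q + 2 := ⟨P.d - 2, by omega⟩
  have hL : (P.L : ℝ) ≠ 0 := P.cast_L_pos.ne'
  rw [eta_eq_inv', pow_eq_pow_mul_pow' (P := P) hjk, hq, Nat.add_sub_cancel, inv_pow, mul_pow, ← pow_mul, ← pow_mul,
    ← pow_mul, ← pow_mul]
  field_simp
  ring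

/-- **THE SCALE-`j` TERM OF THE OBJECT OF RECORD WITH THE `η^d` WEIGHT** (`j ≤ k`, `j ≤ m + K`, every `d ≥ 2`, ANY radius schedule `ρ`):
given the sup member of (7.2.2) for the scale-`j` Landau kernel and a (2.5)-analogue bound for the `C^{(j)}_{loc}` of record at radius
`ρ_j/4`, `Σ_{b″} η_k^d|G^{(j),η}_{loc}(b,b″)|·e^{a·dist_k(b″,b)} ≤ M²M_C·d³e^{a/2}K(a)³·(L^{k−j})^{−2}` — §3 with `h = H_{j,loc}` (file 1's
`abs_hlKer_le_of_sup`), `C = C^{(j),L^jη}_{loc} = (L^{k−j})^{d−2}C^{(j)}_{loc}` (file 1's `abs_clKer_ambient_le`) and `eta_pow_scaling`.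
[cite: BalabanImbrieJaffe1988, (2.13) p.261] -/
theorem weighted_rowsum_termLoc_le (hd : 2 ≤ P.d) {k j : ℕ} (hj : j ≤ P.m + P.K) (hjk : j ≤ k) {a : ℝ} (ha : 0 < a)
    {δ M δC MC : ℝ} (hδ : 0 < δ) (hδC : 0 < δC) (hMC : 0 ≤ MC)
    (hH : ∀ (μ ν : Fin P.d) (x : TSite P 0) (y : TSite P j),
      |(torusRep P j (deltaAData hj a)).H (x, μ) (y, ν)| ≤ M * Real.exp (-(δ * distEU P j x y)))
    (ρ : ℕ → ℝ)
    (hCl : ∀ b₁ b₂ : PBond P j, |Cloc P j (ρ j / 4) b₁ b₂| ≤ MC * Real.exp (-(δC * (supDist b₁.src b₂.src : ℝ))))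
    (b : PBond P 0) :
    ∑ b'' : PBond P 0, (P.eta k) ^ P.d * |termKer (P := P) ((P.eta k) ^ P.d) ((P.L : ℝ) ^ k) ρ j b b''| *
        Real.exp (min δ δC / 2 * kdist (P := P) k b'' b) ≤
      M ^ 2 * MC * (P.d : ℝ) ^ 3 * (Real.exp (min δ δC / 2 / 2) * ((2 * (1 + P.d / (min δ δC / 2))) ^ P.d) ^ 3) *
        (((P.L : ℝ) ^ (k - j)) ^ 2)⁻¹ := by
  have hw : 0 < (P.eta k) ^ P.d := pow_pos (eta_pos P k) _
  have hc : (P.L : ℝ) ^ k ≠ 0 := (cast_pow_L_pos' k).ne'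
  have hM : 0 ≤ M := by
    have h := hH ⟨0, P.hd⟩ ⟨0, P.hd⟩ default default
    exact (mul_nonneg_iff_of_pos_right (Real.exp_pos _)).1 ((abs_nonneg _).trans h)
  have hMC' : 0 ≤ MC * ((P.L : ℝ) ^ (k - j)) ^ (P.d - 2) := mul_nonneg hMC (pow_pos (cast_pow_L_pos' _) _).le
  have h3 := weighted_rowsum_triple_le (k := k) hj hjk hδ hδC hM hMC' (abs_hlKer_le_of_sup hj hw hc ha hH (ρ j / 16) (ρ j / 8))
    (abs_clKer_ambient_le hd hjk hCl) b
  have e : ∀ b'' : PBond P 0, (P.eta k) ^ P.d * |termKer (P := P) ((P.eta k) ^ P.d) ((P.L : ℝ) ^ k) ρ j b b''| *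
      Real.exp (min δ δC / 2 * kdist (P := P) k b'' b) = (P.eta k) ^ P.d *
        (|∑ b₁ : PBond P j, ∑ b₂ : PBond P j, hlKer (P := P) ((P.eta k) ^ P.d) ((P.L : ℝ) ^ k) (ρ j / 16) (ρ j / 8) j b b₁ *
            clKer (P := P) ((P.eta k) ^ P.d) ((P.L : ℝ) ^ k) (ρ j / 4) j b₁ b₂ *
            hlKer (P := P) ((P.eta k) ^ P.d) ((P.L : ℝ) ^ k) (ρ j / 16) (ρ j / 8) j b'' b₂| *
          Real.exp (min δ δC / 2 * kdist (P := P) k b'' b)) := by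
    intro b''; unfold termKer; ring
  rw [Finset.sum_congr rfl fun b'' _ => e b'', ← Finset.mul_sum]
  calc (P.eta k) ^ P.d * _ ≤ (P.eta k) ^ P.d * (M ^ 2 * (MC * ((P.L : ℝ) ^ (k - j)) ^ (P.d - 2)) * (P.d : ℝ) ^ 3 *
        (Real.exp (min δ δC / 2 / 2) * ((2 * (1 + P.d / (min δ δC / 2))) ^ P.d) ^ 3) * ((P.L : ℝ) ^ j) ^ P.d) :=
        mul_le_mul_of_nonneg_left h3 hw.le
    _ = M ^ 2 * MC * (P.d : ℝ) ^ 3 * (Real.exp (min δ δC / 2 / 2) * ((2 * (1 + P.d / (min δ δC / 2))) ^ P.d) ^ 3) *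
        ((P.eta k) ^ P.d * ((P.L : ℝ) ^ (k - j)) ^ (P.d - 2) * ((P.L : ℝ) ^ j) ^ P.d) := by ring
    _ = _ := by rw [eta_pow_scaling hd hjk]

/-- `Σ_{j<k} (L^{k−j})^{−2} ≤ 1` (`L ≥ 2`; even `Σ_{j<k} L^{−(k−j)} ≤ 1`, induction `S_{k+1} = L⁻¹(S_k + 1)`). [folklore] -/
private theorem sum_inv_pow_sq_le_one (k : ℕ) : ∑ j ∈ Finset.range k, (((P.L : ℝ) ^ (k - j)) ^ 2)⁻¹ ≤ 1 := by
  have hL : (2 : ℝ) ≤ P.L := by exact_mod_cast P.hL.2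
  have hmain : ∀ k : ℕ, ∑ j ∈ Finset.range k, ((P.L : ℝ) ^ (k - j))⁻¹ ≤ 1 := by
    intro k
    induction k with
    | zero => simp
    | succ k ih =>
      have e : ∑ j ∈ Finset.range (k + 1), ((P.L : ℝ) ^ (k + 1 - j))⁻¹ =
          (P.L : ℝ)⁻¹ * (∑ j ∈ Finset.range k, ((P.L : ℝ) ^ (k - j))⁻¹ + 1) := by
        rw [Finset.sum_range_succ, show k + 1 - k = 1 by omega, pow_one, mul_add, mul_one, Finset.mul_sum]
        refine congrArg (· + _) (Finset.sum_congr rfl fun j hj => ?_)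
        rw [show k + 1 - j = (k - j) + 1 by have := Finset.mem_range.1 hj; omega, pow_succ, mul_inv, mul_comm]
      rw [e]
      calc (P.L : ℝ)⁻¹ * (∑ j ∈ Finset.range k, ((P.L : ℝ) ^ (k - j))⁻¹ + 1) ≤ 2⁻¹ * (1 + 1) :=
            mul_le_mul ((inv_le_inv₀ (by linarith) two_pos).2 hL) (by linarith) (by positivity) (by norm_num)
        _ = 1 := by norm_num
  refine le_trans (Finset.sum_le_sum fun j _ => ?_) (hmain k)
  have hℓ1 : (1 : ℝ) ≤ (P.L : ℝ) ^ (k - j) := one_le_pow₀ (by linarith)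
  have hℓ0 : (0 : ℝ) < (P.L : ℝ) ^ (k - j) := by linarith
  rw [inv_le_inv₀ (by positivity) hℓ0]
  nlinarith

/-- **THE `η`-LATTICE ROW SUMS OF `𝒟_{k,loc}` AGAINST THE EXPONENTIAL WEIGHT ARE BOUNDED, uniformly in `k ≤ m + K` and in `ρ`**:
`Σ_{b″∈T_η} η_k^d|𝒟_{k,loc}(b,b″)|·e^{a·dist_k(b″,b)} ≤ M²M_C·d³e^{a/2}K(a)³`, `a = min(δ,δ_C)/2`, given the sup member of (7.2.2) for every
`H_j`, `j < k`, and the (2.5)-analogue for the `C^{(j)}_{loc}` of record — the scale terms `≲ (L^{k−j})^{−2}` are summable with no distance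
threshold (p08 g4's regime `Λ < 1`). [cite: BalabanImbrieJaffe1988, (2.13) p.261] -/
theorem weighted_rowsum_dkLocKer_le (hd : 2 ≤ P.d) {k : ℕ} (hk : k ≤ P.m + P.K) {a : ℝ} (ha : 0 < a) {δ M δC MC : ℝ} (hδ : 0 < δ)
    (hδC : 0 < δC) (hMC : 0 ≤ MC)
    (hH : ∀ (j : ℕ) (hj : j ≤ P.m + P.K), j < k → ∀ (μ ν : Fin P.d) (x : TSite P 0) (y : TSite P j),
      |(torusRep P j (deltaAData hj a)).H (x, μ) (y, ν)| ≤ M * Real.exp (-(δ * distEU P j x y)))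
    (ρ : ℕ → ℝ)
    (hCl : ∀ j < k, ∀ b₁ b₂ : PBond P j, |Cloc P j (ρ j / 4) b₁ b₂| ≤ MC * Real.exp (-(δC * (supDist b₁.src b₂.src : ℝ))))
    (b : PBond P 0) :
    ∑ b'' : PBond P 0, (P.eta k) ^ P.d * |dkLocKer (P := P) ((P.eta k) ^ P.d) ((P.L : ℝ) ^ k) ρ k b b''| *
        Real.exp (min δ δC / 2 * kdist (P := P) k b'' b) ≤
      M ^ 2 * MC * (P.d : ℝ) ^ 3 * (Real.exp (min δ δC / 2 / 2) * ((2 * (1 + P.d / (min δ δC / 2))) ^ P.d) ^ 3) := by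
  have hw : 0 ≤ (P.eta k) ^ P.d := (pow_pos (eta_pos P k) _).le
  set S : ℝ := M ^ 2 * MC * (P.d : ℝ) ^ 3 * (Real.exp (min δ δC / 2 / 2) * ((2 * (1 + P.d / (min δ δC / 2))) ^ P.d) ^ 3) with hS
  have hS0 : 0 ≤ S := by positivity
  have hterm : ∀ j ∈ Finset.range k, ∑ b'' : PBond P 0, (P.eta k) ^ P.d *
      |termKer (P := P) ((P.eta k) ^ P.d) ((P.L : ℝ) ^ k) ρ j b b''| * Real.exp (min δ δC / 2 * kdist (P := P) k b'' b) ≤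
        S * (((P.L : ℝ) ^ (k - j)) ^ 2)⁻¹ := by
    intro j hjm
    have hjk : j < k := Finset.mem_range.1 hjm
    have hj : j ≤ P.m + P.K := by omega
    exact weighted_rowsum_termLoc_le hd hj hjk.le ha hδ hδC hMC (hH j hj hjk) ρ (hCl j hjk) b
  calc ∑ b'' : PBond P 0, (P.eta k) ^ P.d * |dkLocKer (P := P) ((P.eta k) ^ P.d) ((P.L : ℝ) ^ k) ρ k b b''| *
          Real.exp (min δ δC / 2 * kdist (P := P) k b'' b)
      ≤ ∑ b'' : PBond P 0, ∑ j ∈ Finset.range k, (P.eta k) ^ P.d *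
          |termKer (P := P) ((P.eta k) ^ P.d) ((P.L : ℝ) ^ k) ρ j b b''| * Real.exp (min δ δC / 2 * kdist (P := P) k b'' b) := by
        refine Finset.sum_le_sum fun b'' _ => ?_
        rw [dkLocKer_eq_sum, ← Finset.sum_mul, ← Finset.mul_sum]
        exact mul_le_mul_of_nonneg_right (mul_le_mul_of_nonneg_left (Finset.abs_sum_le_sum_abs _ _) hw) (Real.exp_pos _).le
    _ = ∑ j ∈ Finset.range k, ∑ b'' : PBond P 0, (P.eta k) ^ P.d *
          |termKer (P := P) ((P.eta k) ^ P.d) ((P.L : ℝ) ^ k) ρ j b b''| * Real.exp (min δ δC / 2 * kdist (P := P) k b'' b) :=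
        Finset.sum_comm
    _ ≤ ∑ j ∈ Finset.range k, S * (((P.L : ℝ) ^ (k - j)) ^ 2)⁻¹ := Finset.sum_le_sum hterm
    _ = S * ∑ j ∈ Finset.range k, (((P.L : ℝ) ^ (k - j)) ^ 2)⁻¹ := by rw [Finset.mul_sum]
    _ ≤ S * 1 := mul_le_mul_of_nonneg_left (sum_inv_pow_sq_le_one k) hS0
    _ = S := mul_one S

/-! ## §5  (2.13) for the object of record: all `b`, no threshold -/

/-- **(2.13) FOR THE CONCRETE `𝒟_{k,loc}`, EXPLICIT CONSTANTS, ALL `b`**: with the `η`-lattice action `(𝒟_{k,loc}f)(b) = Σ_{b″} η_k^d𝒟_{k,loc}(b,b″)f(b″)`,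
`|(𝒟_{k,loc}f)(b)| ≤ M²M_C·d³e^{a/2}K(a)³·e^{−a·dist_k(suppt f, b)}·‖f‖_∞`, `a = min(δ, δ_C)/2`, for every `k ≤ m + K`, every radius schedule `ρ`,
every `f : T_η-bonds → ℝ` and EVERY bond `b`, given the sup member of (7.2.2) for the `H_j` and the (2.5)-analogue for the `C^{(j)}_{loc}` of record —
*"Thus |(𝒟_{k,loc}f)(b)| ≦ ce^{−c dist(suppt f,b)}‖f‖_∞ (2.13)"*. [cite: BalabanImbrieJaffe1988, (2.13) p.261] -/
theorem abs_apply_dkLoc_le (hd : 2 ≤ P.d) {k : ℕ} (hk : k ≤ P.m + P.K) {a : ℝ} (ha : 0 < a) {δ M δC MC : ℝ} (hδ : 0 < δ)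
    (hδC : 0 < δC) (hMC : 0 ≤ MC)
    (hH : ∀ (j : ℕ) (hj : j ≤ P.m + P.K), j < k → ∀ (μ ν : Fin P.d) (x : TSite P 0) (y : TSite P j),
      |(torusRep P j (deltaAData hj a)).H (x, μ) (y, ν)| ≤ M * Real.exp (-(δ * distEU P j x y)))
    (ρ : ℕ → ℝ)
    (hCl : ∀ j < k, ∀ b₁ b₂ : PBond P j, |Cloc P j (ρ j / 4) b₁ b₂| ≤ MC * Real.exp (-(δC * (supDist b₁.src b₂.src : ℝ))))
    (f : PBond P 0 → ℝ) (b : PBond P 0) :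
    |applyK (fun b b'' => (P.eta k) ^ P.d * dkLocKer (P := P) ((P.eta k) ^ P.d) ((P.L : ℝ) ^ k) ρ k b b'') f b| ≤
      M ^ 2 * MC * (P.d : ℝ) ^ 3 * (Real.exp (min δ δC / 2 / 2) * ((2 * (1 + P.d / (min δ δC / 2))) ^ P.d) ^ 3) *
        Real.exp (-(min δ δC / 2) * suppDist (fun a b => kdist (P := P) k a b) f b) * supNorm f := by
  have ha₀ : 0 ≤ min δ δC / 2 := (half_pos (lt_min hδ hδC)).le
  have hw : 0 ≤ (P.eta k) ^ P.d := (pow_pos (eta_pos P k) _).le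
  refine abs_applyK_le_of_weighted_rowsum (dist := fun a b => kdist (P := P) k a b) ha₀ ?_ f
  have e : ∀ b'' : PBond P 0, |(P.eta k) ^ P.d * dkLocKer (P := P) ((P.eta k) ^ P.d) ((P.L : ℝ) ^ k) ρ k b b''| =
      (P.eta k) ^ P.d * |dkLocKer (P := P) ((P.eta k) ^ P.d) ((P.L : ℝ) ^ k) ρ k b b''| := by
    intro b''; rw [abs_mul, abs_of_nonneg hw]
  simp only [e]
  exact weighted_rowsum_dkLocKer_le hd hk ha hδ hδC hMC hH ρ hCl b

/-- **(2.13) ON THE TORI FROM THE TYPED (7.2.2) ALONE**, constants UNIFORM IN `k` AND IN THE RADIUS SCHEDULE: given r15's `KernelData.Ineq722`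
for p09's kernel family (scales covering the standing range) — the `C^{(j)}_{loc}` input being p09 g8's HYPOTHESIS-FREE `cloc_decay` —
`∃ c₁ δ′, 0 < δ′ ∧ 0 ≤ c₁ ∧ ∀ k ≤ m + K, ∀ ρ f b, |(𝒟_{k,loc}f)(b)| ≤ c₁e^{−δ′dist_k(suppt f,b)}‖f‖_∞`. [cite: BalabanImbrieJaffe1988, (2.13) p.261] -/
theorem opDecay213_dkLoc_of_ineq722 (hd : 2 ≤ P.d) {lev : ℕ → ℕ} (hlev : ∀ i, lev i ≤ P.m + P.K)
    (hcov : ∀ j ≤ P.m + P.K, ∃ i, lev i = j) {a : ℝ} {BondU : ℕ → Type}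
    {distEB : (i : ℕ) → TSite P 0 → BondU i → ℝ} {Cker : (i : ℕ) → Fin P.d → Fin P.d → TSite P (lev i) → TSite P (lev i) → ℝ}
    {Dker : (i : ℕ) → TSite P 0 → BondU i → ℝ}
    (h722 : KernelData.Ineq722
      (fun i => torusKernelData P (lev i) (deltaAData (hlev i) a) (BondU i) (distEB i) (Cker i) (Dker i))) (ha : 0 < a) :
    ∃ c₁ δ' : ℝ, 0 < δ' ∧ 0 ≤ c₁ ∧ ∀ (k : ℕ) (_ : k ≤ P.m + P.K) (ρ : ℕ → ℝ) (f : PBond P 0 → ℝ) (b : PBond P 0),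
        |applyK (fun b b'' => (P.eta k) ^ P.d * dkLocKer (P := P) ((P.eta k) ^ P.d) ((P.L : ℝ) ^ k) ρ k b b'') f b| ≤
          c₁ * Real.exp (-δ' * suppDist (fun a b => kdist (P := P) k a b) f b) * supNorm f := by
  obtain ⟨δ, M, hδ, -, hBall⟩ := exists_bound_of_ineq722 hlev h722
  obtain ⟨MC, δC, hMC, hδC, HC⟩ := cloc_decay P.d P.L hd
  refine ⟨M ^ 2 * MC * (P.d : ℝ) ^ 3 * (Real.exp (min δ δC / 2 / 2) * ((2 * (1 + P.d / (min δ δC / 2))) ^ P.d) ^ 3),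
    min δ δC / 2, half_pos (lt_min hδ hδC), by positivity, fun k hk ρ f b => ?_⟩
  have hH : ∀ (j : ℕ) (hj : j ≤ P.m + P.K), j < k → ∀ (μ ν : Fin P.d) (x : TSite P 0) (y : TSite P j),
      |(torusRep P j (deltaAData hj a)).H (x, μ) (y, ν)| ≤ M * Real.exp (-(δ * distEU P j x y)) := by
    intro j hj _ μ ν x y
    obtain ⟨i, hi⟩ := hcov j hj
    subst hi
    exact (le_add_of_nonneg_right torusKernelData_gradH_nonneg).trans (hBall i μ ν x y)
  have hCl : ∀ j < k, ∀ b₁ b₂ : PBond P j,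
      |Cloc P j (ρ j / 4) b₁ b₂| ≤ MC * Real.exp (-(δC * (supDist b₁.src b₂.src : ℝ))) := by
    intro j hjk b₁ b₂
    have h := HC P rfl rfl j inferInstance (by omega) (ρ j / 4) b₁ b₂
    rwa [distB_apply] at h
  exact abs_apply_dkLoc_le hd hk ha hδ hδC hMC.le hH ρ hCl f b

/-- **(2.13) ON THE TORI GIVEN ONLY [6I] PROPOSITION 1.2 BY ITS TREE NAME** (`B5.Prop12Printed` for p09's family of scales `levStd` — the `h12`
of rows C1.Eq7.2.1-7.2.2 / C2.Eq2.16): for the concrete (2.12) of record acting on `η`-lattice functions with the `η^d` pairing weight,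
`∃ c₁ δ′, 0 < δ′ ∧ 0 ≤ c₁ ∧ ∀ k ≤ m + K, ∀ ρ f b, |(𝒟_{k,loc}f)(b)| ≤ c₁e^{−δ′dist_k(suppt f, b)}‖f‖_∞` — ALL `b`, no threshold, uniform in `k`
and in the radius schedule; (7.2.2) via p09's `ineq722_deltaA_of_prop12Printed`, the `C^{(j)}_{loc}` estimate HYPOTHESIS-FREE (p09 g8).
[cite: BalabanImbrieJaffe1988, (2.13) p.261] -/
theorem opDecay213_dkLoc_prop12 (hd : 2 ≤ P.d) {a : ℝ} (ha : 0 < a)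
    (h12 : B5.Prop12Printed (fun i => settingOf (torusRep P (levStd P i) (deltaAData (levStd_le i) a)) i)) :
    ∃ c₁ δ' : ℝ, 0 < δ' ∧ 0 ≤ c₁ ∧ ∀ (k : ℕ) (_ : k ≤ P.m + P.K) (ρ : ℕ → ℝ) (f : PBond P 0 → ℝ) (b : PBond P 0),
        |applyK (fun b b'' => (P.eta k) ^ P.d * dkLocKer (P := P) ((P.eta k) ^ P.d) ((P.L : ℝ) ^ k) ρ k b b'') f b| ≤
          c₁ * Real.exp (-δ' * suppDist (fun a b => kdist (P := P) k a b) f b) * supNorm f :=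
  opDecay213_dkLoc_of_ineq722 hd levStd_le (fun j hj => ⟨j, min_eq_left hj⟩)
    (ineq722_deltaA_of_prop12Printed (levStd P) levStd_le ha (fun _ => PUnit) (fun _ _ _ => 0) (fun _ _ _ _ _ => 0)
      (fun _ _ _ => 0) h12) ha

/-- `dist(suppt f, b)` scales with the distance: `suppDist (κ·dist) f b = κ·suppDist dist f b` for `κ ≥ 0`. [folklore] -/
private theorem suppDist_smul {α β : Type*} {dist : α → β → ℝ} {κ : ℝ} (hκ : 0 ≤ κ) (f : α → ℝ) (b : β) :
    suppDist (fun a b => κ * dist a b) f b = κ * suppDist dist f b := by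
  unfold suppDist
  rw [Real.mul_iInf_of_nonneg hκ]

/-- **(2.13), THE TYPED ROW INHABITED FOR THE OBJECT OF RECORD**: r18's one-letter `OpDecay dist 𝒟_{k,loc} c` (`|(𝒟f)(b)| ≤ ce^{−c dist(suppt f,b)}‖f‖_∞`)
— which, with prefactor = rate, can only be met in a RESCALED distance `κ·dist_k` — holds for the `η^d`-weighted kernel of `dkLocKer` with ONE pair
`(κ, c)`, `κ, c > 0`, for all `k ≤ m + K` and all radius schedules, given only `B5.Prop12Printed`. [cite: BalabanImbrieJaffe1988, (2.13) p.261] -/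
theorem opDecay213_dkLoc_typed_prop12 (hd : 2 ≤ P.d) {a : ℝ} (ha : 0 < a)
    (h12 : B5.Prop12Printed (fun i => settingOf (torusRep P (levStd P i) (deltaAData (levStd_le i) a)) i)) :
    ∃ κ c : ℝ, 0 < κ ∧ 0 < c ∧ ∀ (k : ℕ) (_ : k ≤ P.m + P.K) (ρ : ℕ → ℝ),
      OpDecay (fun a b => κ * kdist (P := P) k a b)
        (fun b b'' => (P.eta k) ^ P.d * dkLocKer (P := P) ((P.eta k) ^ P.d) ((P.L : ℝ) ^ k) ρ k b b'') c := by
  obtain ⟨c₁, δ', hδ', hc₁, H⟩ := opDecay213_dkLoc_prop12 hd ha h12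
  have hc : 0 < max c₁ δ' := lt_max_of_lt_right hδ'
  refine ⟨δ' / max c₁ δ', max c₁ δ', by positivity, hc, fun k hk ρ f b => ?_⟩
  have h := H k hk ρ f b
  have hκ : 0 ≤ δ' / max c₁ δ' := by positivity
  rw [suppDist_smul hκ]
  have e : -max c₁ δ' * (δ' / max c₁ δ' * suppDist (fun a b => kdist (P := P) k a b) f b) =
      -δ' * suppDist (fun a b => kdist (P := P) k a b) f b := by
    field_simp
  rw [e]
  refine h.trans (mul_le_mul_of_nonneg_right (mul_le_mul_of_nonneg_right (le_max_left _ _) (Real.exp_pos _).le)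
    (supNorm_nonneg f))

end

end Literature.MathematicalPhysics.QuantumFieldTheory.BalabanImbrieJaffe1984to88.BIJ88OpDecay213DkLocTorus
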